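import Mathlib
import HarnessLib
import Literature.Computability.AlgebraicComplexity.PatternExpressions
import Literature.Combinatorics.SimpleGraph.TreeDecomposition
import Literature.Combinatorics.SimpleGraph.ChordalTreeDecomposition
import Summits.ValiantsHypothesis.ValiantsHypothesis.Theorems.MonotoneRestorationOrbitRestorationQPHomSpanAdmissible
import Summits.ValiantsHypothesis.ValiantsHypothesis.Theorems.MonotoneRestorationOrbitRestorationQPHomSpanNarrowFloor
import Summits.ValiantsHypothesis.ValiantsHypothesis.Theorems.MonotoneRestorationMonotoneRestorationQPLinearWidthNarrowDetermined
import Summits.ValiantsHypothesis.ValiantsHypothesis.Theorems.MonotoneRestorationMonotoneRestorationQPLinearWidthCaterpillarHom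

/-!
# Route MonotoneRestoration, crux `MonotoneRestorationQP` (stmt-15886), line `linear-width` —
# DETERMINED versus NARROW: the two width currencies of the route agree at the ends of the scale,
# and GAP 2 has the polylog-degree floor

Helper file (`--supports stmt-ValiantsHypothesis-15886`), def-free.  Two currencies for "width `< k`" of a
matrix-symmetric polynomial `p` at level `n` are in use on the route: DETERMINED — `p` takes equal values
at points hom-indistinguishable below treewidth `k` (`HomIndist n k`, line `linear-width`; the family form
is `PolylogHomDetermined` / GAP 2 `HomDeterminedVP`) — and NARROW — `p` lies in the `ℂ`-span of the
`hom_{F,n}` with `tw F < k` (K1 `stub_narrowExpansionVP` of line `narrow-expansion`, crux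
`OrbitRestorationQP`).  NARROW ⇒ DETERMINED is `NarrowDetermined.eval_eq_of_mem_narrowSpan`; whether
DETERMINED ⇒ NARROW (which, with the landed K2/K3, would reduce `WidthRestorationQP` to bookkeeping) is
OPEN in general — a subalgebra of a polynomial ring need not contain every polynomial constant on its
level sets.  This file certifies the two ENDS of the scale and the floor of GAP 2:

* `eval_homPoly_eq_of_treewidth_lt_one`, `homIndist_one` — BOTTOM: below treewidth `1` only edgeless
  patterns occur (an edge is a `2`-clique, `card_le_treewidth_add_one_of_isClique`), whose homomorphism
  polynomials are the constants `n^{a+b}`; so `HomIndist n 1 A B` holds for ALL `A, B`;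
* `eq_C_of_determined_one`, `mem_narrowSpan_zero_of_determined_one` — hence a polynomial determined by
  `HomIndist n 1` is constant (`MvPolynomial.funext`) and lies in the narrow span of width `0`
  (`hom_{∅,n} = 1`): DETERMINED = NARROW = constants at `k = 1`;
* `mem_narrowSpan_top` — TOP: every matrix-symmetric `p` lies in the span of the `hom_{F,n}` with
  `tw F ≤ 2n - 1` (admissible patterns have `≤ n` vertices a side,
  `HomSpan.mem_span_admissible_of_matrixSymmetric`), so NARROW holds for all matrix-symmetric `p` from
  `k = 2n` on, as DETERMINED does from `k = 4·(n!)²` on (`OrbitSeparation.eval_eq_of_homIndist_of_matrixSymmetric`);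
* `polylogHomDetermined_of_polylogDegree` — THE FLOOR OF GAP 2: every matrix-symmetric family of
  polylogarithmic degree is `PolylogHomDetermined` (line `linear-width`, unfolded verbatim), with NO `VP`
  hypothesis — `HomSpan.narrowExpansion_of_polylogDegree` + `NarrowDetermined`; the analogue for
  `stub_homDeterminedVP` of the rung's floor `widthRung_polylogDegree`.

Honest label: calibration; no stub closed; VP ≠ VNP not moved. [cite: DwivediPagoSeppelt2026, Def. 3.2, §8]
-/

-- `Summit.ValiantsHypothesis.ValiantsHypothesis.…` is the tree's mandated namespace (Sub = Summit).
set_option linter.dupNamespace false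

noncomputable section

namespace Summit.ValiantsHypothesis.ValiantsHypothesis.Theorems

namespace DeterminedVsNarrow

open Literature.Computability.AlgebraicComplexity MvPolynomial

variable {n : ℕ}

/-! ### Bottom of the scale: `k = 1` -/

/-- A pattern whose pattern graph has treewidth `< 1` has no edges. [folklore] -/
theorem eq_zero_of_treewidth_lt_one {a b : ℕ} (E : Multiset (Fin a × Fin b))
    (hE : Literature.Combinatorics.SimpleGraph.treewidth
      (SimpleGraph.fromRel fun u v : Fin a ⊕ Fin b => ∃ p ∈ E, u = Sum.inl p.1 ∧ v = Sum.inr p.2) < 1) :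
    E = 0 := by
  classical
  by_contra hne
  obtain ⟨e, he⟩ := Multiset.exists_mem_of_ne_zero hne
  have hcl : (SimpleGraph.fromRel fun u v : Fin a ⊕ Fin b =>
      ∃ p ∈ E, u = Sum.inl p.1 ∧ v = Sum.inr p.2).IsClique
      (({Sum.inl e.1, Sum.inr e.2} : Finset (Fin a ⊕ Fin b)) : Set (Fin a ⊕ Fin b)) := by
    rw [Finset.coe_insert, Finset.coe_singleton]
    refine SimpleGraph.isClique_pair.2 ?_
    intro _
    rw [SimpleGraph.fromRel_adj]
    exact ⟨Sum.inl_ne_inr, Or.inl ⟨e, he, rfl, rfl⟩⟩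
  have h2 := Literature.Combinatorics.SimpleGraph.card_le_treewidth_add_one_of_isClique hcl
  rw [Finset.card_insert_of_notMem (by simp), Finset.card_singleton] at h2
  omega

/-- **Below treewidth `1` homomorphism polynomials are constants**: `hom_{E,n}(A) = hom_{E,n}(B)` for
all `A, B` when `tw E < 1`. [folklore] -/
theorem eval_homPoly_eq_of_treewidth_lt_one {a b : ℕ} (E : Multiset (Fin a × Fin b))
    (hE : Literature.Combinatorics.SimpleGraph.treewidth
      (SimpleGraph.fromRel fun u v : Fin a ⊕ Fin b => ∃ p ∈ E, u = Sum.inl p.1 ∧ v = Sum.inr p.2) < 1)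
    (A B : Fin n × Fin n → ℂ) :
    eval A (homPoly E n ℂ) = eval B (homPoly E n ℂ) := by
  rw [eq_zero_of_treewidth_lt_one E hE, CaterpillarHom.eval_homPoly, CaterpillarHom.eval_homPoly]
  simp

/-- **`HomIndist n 1 A B` holds for all `A, B`** (line `linear-width`, unfolded verbatim). [folklore] -/
theorem homIndist_one (A B : Fin n × Fin n → ℂ) :
    ∀ (a b : ℕ) (E : Multiset (Fin a × Fin b)),
      Literature.Combinatorics.SimpleGraph.treewidth
        (SimpleGraph.fromRel fun u v : Fin a ⊕ Fin b => ∃ p ∈ E, u = Sum.inl p.1 ∧ v = Sum.inr p.2) < 1 →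
      eval A (homPoly E n ℂ) = eval B (homPoly E n ℂ) :=
  fun _ _ E hE => eval_homPoly_eq_of_treewidth_lt_one E hE A B

/-- **A polynomial determined by `HomIndist n 1` is constant.** [folklore] -/
theorem eq_C_of_determined_one (p : MvPolynomial (Fin n × Fin n) ℂ)
    (hp : ∀ A B : Fin n × Fin n → ℂ,
      (∀ (a b : ℕ) (E : Multiset (Fin a × Fin b)),
        Literature.Combinatorics.SimpleGraph.treewidth
          (SimpleGraph.fromRel fun u v : Fin a ⊕ Fin b => ∃ p ∈ E, u = Sum.inl p.1 ∧ v = Sum.inr p.2) < 1 →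
        eval A (homPoly E n ℂ) = eval B (homPoly E n ℂ)) →
      eval A p = eval B p) :
    p = C (eval 0 p) := by
  refine MvPolynomial.funext fun A => ?_
  rw [eval_C]
  exact hp A 0 (homIndist_one A 0)

/-- The homomorphism polynomial of the empty pattern on no vertices is `1`. [folklore] -/
theorem homPoly_empty : homPoly (0 : Multiset (Fin 0 × Fin 0)) n ℂ = 1 := by
  unfold homPoly
  simp

/-- **DETERMINED = NARROW at `k = 1`**: a polynomial determined by `HomIndist n 1` lies in the span of the
`hom_{F,n}` with `tw F ≤ 0` (indeed it is a multiple of `hom_{∅,n} = 1`). [folklore] -/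
theorem mem_narrowSpan_zero_of_determined_one (p : MvPolynomial (Fin n × Fin n) ℂ)
    (hp : ∀ A B : Fin n × Fin n → ℂ,
      (∀ (a b : ℕ) (E : Multiset (Fin a × Fin b)),
        Literature.Combinatorics.SimpleGraph.treewidth
          (SimpleGraph.fromRel fun u v : Fin a ⊕ Fin b => ∃ p ∈ E, u = Sum.inl p.1 ∧ v = Sum.inr p.2) < 1 →
        eval A (homPoly E n ℂ) = eval B (homPoly E n ℂ)) →
      eval A p = eval B p) :
    p ∈ Submodule.span ℂ
      {q : MvPolynomial (Fin n × Fin n) ℂ | ∃ (a b : ℕ) (E : Multiset (Fin a × Fin b)),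
        Literature.Combinatorics.SimpleGraph.treewidth
            (SimpleGraph.fromRel fun u v : Fin a ⊕ Fin b =>
              ∃ e ∈ E, u = Sum.inl e.1 ∧ v = Sum.inr e.2) ≤ 0 ∧
          q = homPoly E n ℂ} := by
  rw [eq_C_of_determined_one p hp, ← mul_one (C (eval 0 p)), ← smul_eq_C_mul]
  refine Submodule.smul_mem _ _ (Submodule.subset_span ⟨0, 0, 0, ?_, homPoly_empty.symm⟩)
  refine (Literature.Combinatorics.SimpleGraph.treewidth_le_card_sub_one _).trans ?_
  simp

/-! ### Top of the scale: `k = 2n` for NARROW -/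

/-- **Every matrix-symmetric polynomial is narrow of width `2n - 1`**: it lies in the span of the
`hom_{F,n}` over patterns of treewidth `≤ 2n - 1` (admissible patterns have `≤ n` vertices a side).
[cite: DwivediPagoSeppelt2026, §8 (Lemma 8.18)] -/
theorem mem_narrowSpan_top (p : MvPolynomial (Fin n × Fin n) ℂ)
    (hp : ∀ σ τ : Equiv.Perm (Fin n), rename (fun ij : Fin n × Fin n => (σ ij.1, τ ij.2)) p = p) :
    p ∈ Submodule.span ℂ
      {q : MvPolynomial (Fin n × Fin n) ℂ | ∃ (a b : ℕ) (E : Multiset (Fin a × Fin b)),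
        Literature.Combinatorics.SimpleGraph.treewidth
            (SimpleGraph.fromRel fun u v : Fin a ⊕ Fin b =>
              ∃ e ∈ E, u = Sum.inl e.1 ∧ v = Sum.inr e.2) ≤ 2 * n - 1 ∧
          q = homPoly E n ℂ} := by
  refine Submodule.span_mono ?_ (HomSpan.mem_span_admissible_of_matrixSymmetric p hp)
  rintro q ⟨a, b, E, ha, hb, -, -, -, -, -, rfl⟩
  refine ⟨a, b, E, (Literature.Combinatorics.SimpleGraph.treewidth_le_card_sub_one _).trans ?_, rfl⟩
  simp only [Fintype.card_sum, Fintype.card_fin]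
  omega

/-- **At every fixed level K1's clause is eventually free**: for `2n - 1 ≤ K`, every matrix-symmetric
polynomial at level `n` lies in the narrow span of width `K` — so, like `PolylogHomDetermined`, the
conclusion of `stub_narrowExpansionVP` constrains a family only through the growth of `(log₂ n + c)^c`.
[folklore] -/
theorem mem_narrowSpan_of_le {K : ℕ} (hK : 2 * n - 1 ≤ K) (p : MvPolynomial (Fin n × Fin n) ℂ)
    (hp : ∀ σ τ : Equiv.Perm (Fin n), rename (fun ij : Fin n × Fin n => (σ ij.1, τ ij.2)) p = p) :
    p ∈ Submodule.span ℂ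
      {q : MvPolynomial (Fin n × Fin n) ℂ | ∃ (a b : ℕ) (E : Multiset (Fin a × Fin b)),
        Literature.Combinatorics.SimpleGraph.treewidth
            (SimpleGraph.fromRel fun u v : Fin a ⊕ Fin b =>
              ∃ e ∈ E, u = Sum.inl e.1 ∧ v = Sum.inr e.2) ≤ K ∧
          q = homPoly E n ℂ} := by
  refine Submodule.span_mono ?_ (mem_narrowSpan_top p hp)
  rintro q ⟨a, b, E, hE, rfl⟩
  exact ⟨a, b, E, hE.trans hK, rfl⟩

/-! ### The floor of GAP 2 -/

/-- **THE POLYLOG-DEGREE FLOOR OF GAP 2 `HomDeterminedVP`**: every matrix-symmetric family of degree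
`≤ (log₂ n + c)^c` is `PolylogHomDetermined` (line `linear-width`, unfolded verbatim) — no `VP` hypothesis.
[cite: DwivediPagoSeppelt2026, Cor. 3.3] -/
theorem polylogHomDetermined_of_polylogDegree (f : (n : ℕ) → MvPolynomial (Fin n × Fin n) ℂ)
    (hsymm : ∀ (n : ℕ) (σ τ : Equiv.Perm (Fin n)),
      rename (fun p : Fin n × Fin n => (σ p.1, τ p.2)) (f n) = f n)
    (hdeg : ∃ c : ℕ, ∀ n : ℕ, (f n).totalDegree ≤ (Nat.log 2 n + c) ^ c) :
    ∃ c : ℕ, ∀ (n : ℕ) (A B : Fin n × Fin n → ℂ),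
      (∀ (a b : ℕ) (E : Multiset (Fin a × Fin b)),
        Literature.Combinatorics.SimpleGraph.treewidth
          (SimpleGraph.fromRel fun u v : Fin a ⊕ Fin b => ∃ p ∈ E, u = Sum.inl p.1 ∧ v = Sum.inr p.2) <
          (Nat.log 2 n + c) ^ c →
        MvPolynomial.eval A (homPoly E n ℂ) = MvPolynomial.eval B (homPoly E n ℂ)) →
      MvPolynomial.eval A (f n) = MvPolynomial.eval B (f n) :=
  NarrowDetermined.polylogHomDetermined_of_narrowExpansion f
    (HomSpan.narrowExpansion_of_polylogDegree f hsymm hdeg)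

end DeterminedVsNarrow

end Summit.ValiantsHypothesis.ValiantsHypothesis.Theorems

end
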